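/-
Copyright (c) 2026 the pub-hodgecm-mathlib formalisation cell (harness21).  Prover seat hodgecm-mathlib-K2E3-p14 (g7), Track B «K2-LIT» ∕ h413
(`stmt-HodgeConjecture-24833`), line `K2_E3_EllipticInputs`, leaf (nsc-S-A′) «principal-block standard span», brick E2-J (part F1a):
THE `GL₂`-RESTRICTION OF THE JACQUET MODULE `r_{P₂₁} V` OF `GL₃(F)` — LEVEL BOOKKEEPING, TRIVIALITY OF THE SMALL `GL₁`-BLOCK, ADMISSIBILITY,
GENERATION BY VECTORS OF BOUNDED LEVEL.  2026-09-04.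
-/
import Literature.NumberTheory.Automorphic.JacquetGLFunctor                       -- ★ `jacquetGLMap` (functoriality of `r_c`)
import Literature.NumberTheory.Automorphic.IwasawaDecompositionGL               -- ★ `exists_borel_mul_glInt` (Iwasawa `G = B·K`)
import Literature.NumberTheory.Automorphic.CongruenceSubgroupExpansionGL        -- ★ `conj_mem_congruenceGL`
import Literature.NumberTheory.Automorphic.ParabolicSemidirect                  -- ★ `continuous_blockDiagonalGL`, `continuous_leviProjection`, `blockDiagonalGL_apply_coe_dite`
import Literature.NumberTheory.Automorphic.ParabolicInductionAdmissibleProofs   -- ★ `continuous_reindexGL`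
import Literature.NumberTheory.Automorphic.ParabolicInductionModulusProofs      -- ★ `jacquetGL_leviProjection_mk`, `isOpen_ker_rootDeltaChar_comp_leviEmbeddingP_inv`
import Literature.NumberTheory.Automorphic.ParabolicIndGLSphericalUnramified    -- ★ `rootDeltaChar_eq_one_of_mem_glInt`
import Literature.NumberTheory.Automorphic.ParabolicGLReindex                   -- ★ `IsSmooth.comp_of_continuous`
import Literature.NumberTheory.Automorphic.SupercuspidalProjectiveGL            -- ★ `IsAdmissible.twist`
import Summits.HodgeConjecture.HodgeConjecture.Theorems.K2E3GL3InductionInStagesLevi   -- ★ E2-I block bookkeeping (`mulSingle_false_mul_mulSingle_true`, …)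
import HarnessLib

/-!
# K2_E3 road (h413), leaf (nsc-S-A′), brick E2-J (part F1a) — the `GL₂`-restriction of `r_{P₂₁} V`: level bookkeeping, the small `GL₁`-block acts
# trivially, admissibility over `GL₂(F)`, generation by vectors of bounded level

Cell `pub/hodgecm-mathlib` (D-0151), Track B, seat K2E3-p14 (g7); leaf architecture K2E3-p25 (g0) `MEMO-SA-architecture.v1` brick E2, head (E2-J)
`exists_gl2_exponent_decomposition` (K2 bus 2026-09-04 08:40:11Z; plan J1∕J2∕J3 «=» 10:07:57Z).  `--supports stmt-HodgeConjecture-24833 --as helper`; THEOREMS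
ONLY (no definition ∕ instance ∕ notation ∕ named fact ∕ `sorry`); never imports `Cruxes/…/Lines`.  COUNT-NEUTRAL.

THE MATHEMATICS ([BernsteinZelevinsky1976, §3.13–3.17, Thm. 4.1]; [BernsteinZelevinsky1977, §1.8–1.9, §2.3 (e)]; [Casselman1995, §3.3, Thm. 6.3.10]).  `Q = P₂₁ ≤ GL₃(F)`
(labelling `![false,false,true]`), Levi `M = GL₂ × GL₁` (`Π a : Bool, GL(block a)`), `ι(g₂) = diag(g₂, 1)` (along `e : Fin 2 ≃ {0,1}`), `d(t) = diag(1,1,t)`, `W = r_Q V` NORMALISED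
(★ `normalizedJacquetGL`).  §1 level bookkeeping `diag(m) ∈ K_γ ⟺ m|_{GL₂} ∈ K_γ ∧ (m|_{GL₁} conditions)`, `d(x)` central, the Levi level `K^L_γ = {m : diag m ∈ K_γ}` compact
open; §2 `W` is `M`-spanned by `K^L_γ`-fixed classes when `V` is spanned by translates of `K_γ`-fixed vectors (Iwasawa, `Bool` twin of ★
`span_jacquetGL_fixedPoints_eq_top_of_subset`); §3 hence CENTRAL `m₀` with `diag m₀ ∈ K_γ` act TRIVIALLY on `W` (all of `d(1 + 𝔭^γ)`), the `GL₂`-RESTRICTION `W ∘ ι` is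
ADMISSIBLE over `GL₂(F)` (given ★ Jacquet's lemma on `M`: `W^{ι K} ⊆ W^{K^L_{γ′}}`) and `GL₂`-spanned by `K_γ`-fixed vectors — the two hypotheses of the
Bernstein–Zelevinsky∕Howe finiteness theorem ★ `isFiniteLength_of_isAdmissible_of_span_eq_top` at `n = 2` (applied in part F1b).

HONEST LABEL: HC_CM is proved only modulo the 7 printed citations (2 remaining named inputs: hLiu418 = stmt-HodgeConjecture-24832, h413 =
stmt-HodgeConjecture-24833) until rung 0 closes; count-neutral helper.

## References
* [BernsteinZelevinsky1976] I. N. Bernstein, A. V. Zelevinsky, Russ. Math. Surveys 31:3 (1976): §3.13–3.17, Thm. 4.1.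
* [BernsteinZelevinsky1977] I. N. Bernstein, A. V. Zelevinsky, Ann. Sci. ÉNS 10 (1977): §1.8–1.9, §2.1, §2.3.
* [Casselman1995] W. Casselman, *Introduction to the theory of admissible representations of p-adic reductive groups* (1995): §3.3, Thm. 6.3.10.
-/

set_option autoImplicit false
set_option linter.dupNamespace false

noncomputable section
open scoped MatrixGroups
namespace Summit.HodgeConjecture.HodgeConjecture.Cruxes.H413.K2E3GL3JacquetRestrictionGL2

open Literature.NumberTheory.Automorphic Representation ValuativeRel
open K2E3GL3InductionInStagesEmbedding K2E3GL3InductionInStagesLevi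

/-! ## §1 Level bookkeeping for the Levi `GL₂ × GL₁` of `P₂₁ ≤ GL₃` -/

section Level

variable {F : Type*} [Field F]
  (e : Fin 2 ≃ {i : Fin 3 // (![false, false, true] : Fin 3 → Bool) i = false})
  (he : ∀ j : Fin 2, ((e j : {i : Fin 3 // (![false, false, true] : Fin 3 → Bool) i = false}) : Fin 3) = Fin.castSucc j)

/-- Entries of `diag(m)` on the diagonal blocks are the entries of the blocks. [cite: BernsteinZelevinsky1977, §2.1] -/
theorem blockDiagonalGL_apply_block (m : (Π a : Bool, GL {i : Fin 3 // (![false, false, true] : Fin 3 → Bool) i = a} F)) (a : Bool) (i j : {k : Fin 3 // (![false, false, true] : Fin 3 → Bool) k = a}) :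
    ((blockDiagonalGL F (![false, false, true] : Fin 3 → Bool) m : GL (Fin 3) F) : Matrix (Fin 3) (Fin 3) F) i.1 j.1 =
      ((m a : GL {k : Fin 3 // (![false, false, true] : Fin 3 → Bool) k = a} F) : Matrix {k : Fin 3 // (![false, false, true] : Fin 3 → Bool) k = a} {k : Fin 3 // (![false, false, true] : Fin 3 → Bool) k = a} F) i j := by
  rw [← coe_leviEmbeddingP, ← leviProjection_apply_coe, leviProjection_leviEmbeddingP_apply]

/-- Entries of `diag(m)` off the diagonal blocks vanish. [cite: BernsteinZelevinsky1977, §2.1] -/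
theorem blockDiagonalGL_apply_of_ne (m : (Π a : Bool, GL {i : Fin 3 // (![false, false, true] : Fin 3 → Bool) i = a} F)) (i j : Fin 3) (h : (![false, false, true] : Fin 3 → Bool) i ≠ (![false, false, true] : Fin 3 → Bool) j) :
    ((blockDiagonalGL F (![false, false, true] : Fin 3 → Bool) m : GL (Fin 3) F) : Matrix (Fin 3) (Fin 3) F) i j = 0 := by
  rw [blockDiagonalGL_apply_coe_dite, dif_neg h]

include he in
/-- Entries of the `GL₂`-block read through the reindexing `e`: `(e⁻¹ m|_{GL₂})_{ij} = diag(m)_{ij}` (`i, j < 2`). [folklore] -/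
theorem reindexGL_symm_block_apply (m : (Π a : Bool, GL {i : Fin 3 // (![false, false, true] : Fin 3 → Bool) i = a} F)) (i j : Fin 2) :
    (((reindexGL e).symm (m false) : GL (Fin 2) F) : Matrix (Fin 2) (Fin 2) F) i j =
      ((blockDiagonalGL F (![false, false, true] : Fin 3 → Bool) m : GL (Fin 3) F) : Matrix (Fin 3) (Fin 3) F) (Fin.castSucc i) (Fin.castSucc j) := by
  rw [reindexGL_symm, coe_reindexGL, Matrix.reindex_apply, Matrix.submatrix_apply, Equiv.symm_symm,
    ← blockDiagonalGL_apply_block m false (e i) (e j), he, he]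

/-- The corner entry `diag(m)₂₂` is the entry of the `GL₁`-block. [folklore] -/
theorem blockDiagonalGL_apply_two_two (m : (Π a : Bool, GL {i : Fin 3 // (![false, false, true] : Fin 3 → Bool) i = a} F)) :
    ((blockDiagonalGL F (![false, false, true] : Fin 3 → Bool) m : GL (Fin 3) F) : Matrix (Fin 3) (Fin 3) F) 2 2 =
      ((m true : GL {i : Fin 3 // (![false, false, true] : Fin 3 → Bool) i = true} F) : Matrix {i : Fin 3 // (![false, false, true] : Fin 3 → Bool) i = true} {i : Fin 3 // (![false, false, true] : Fin 3 → Bool) i = true} F) (⟨2, rfl⟩ : {i : Fin 3 // (![false, false, true] : Fin 3 → Bool) i = true}) (⟨2, rfl⟩ : {i : Fin 3 // (![false, false, true] : Fin 3 → Bool) i = true}) :=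
  blockDiagonalGL_apply_block m true (⟨2, rfl⟩ : {i : Fin 3 // (![false, false, true] : Fin 3 → Bool) i = true}) (⟨2, rfl⟩ : {i : Fin 3 // (![false, false, true] : Fin 3 → Bool) i = true})

/-- `diag(m)_{i2} = 0` for `i < 2`. [folklore] -/
theorem blockDiagonalGL_apply_castSucc_two (m : (Π a : Bool, GL {i : Fin 3 // (![false, false, true] : Fin 3 → Bool) i = a} F)) (i : Fin 2) :
    ((blockDiagonalGL F (![false, false, true] : Fin 3 → Bool) m : GL (Fin 3) F) : Matrix (Fin 3) (Fin 3) F) (Fin.castSucc i) 2 = 0 :=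
  blockDiagonalGL_apply_of_ne m _ _ (by rw [twoOne_castSucc]; decide)

/-- `diag(m)_{2j} = 0` for `j < 2`. [folklore] -/
theorem blockDiagonalGL_apply_two_castSucc (m : (Π a : Bool, GL {i : Fin 3 // (![false, false, true] : Fin 3 → Bool) i = a} F)) (j : Fin 2) :
    ((blockDiagonalGL F (![false, false, true] : Fin 3 → Bool) m : GL (Fin 3) F) : Matrix (Fin 3) (Fin 3) F) 2 (Fin.castSucc j) = 0 :=
  blockDiagonalGL_apply_of_ne m _ _ (by rw [twoOne_castSucc]; decide)

variable [ValuativeRel F]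

include he in
/-- **LEVEL BOOKKEEPING**: `diag(m)` lies in the principal congruence subgroup `K_γ ≤ GL₃` iff its `GL₂`-block (read through `e`) lies in `K_γ ≤ GL₂` and its
`GL₁`-entry `t` satisfies `|t|, |t⁻¹| ≤ 1`, `|t − 1|, |t⁻¹ − 1| ≤ γ` (all conditions are entrywise). [cite: BernsteinZelevinsky1976, §3.13] -/
theorem blockDiagonalGL_mem_congruenceGL_iff (γ : ValueGroupWithZero F) (m : (Π a : Bool, GL {i : Fin 3 // (![false, false, true] : Fin 3 → Bool) i = a} F)) :
    blockDiagonalGL F (![false, false, true] : Fin 3 → Bool) m ∈ congruenceGL 3 γ ↔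
      (reindexGL e).symm (m false) ∈ congruenceGL 2 γ ∧
        (valuation F (((m true : GL {i : Fin 3 // (![false, false, true] : Fin 3 → Bool) i = true} F) : Matrix {i : Fin 3 // (![false, false, true] : Fin 3 → Bool) i = true} {i : Fin 3 // (![false, false, true] : Fin 3 → Bool) i = true} F) (⟨2, rfl⟩ : {i : Fin 3 // (![false, false, true] : Fin 3 → Bool) i = true}) (⟨2, rfl⟩ : {i : Fin 3 // (![false, false, true] : Fin 3 → Bool) i = true})) ≤ 1 ∧
          valuation F (((m⁻¹ true : GL {i : Fin 3 // (![false, false, true] : Fin 3 → Bool) i = true} F) : Matrix {i : Fin 3 // (![false, false, true] : Fin 3 → Bool) i = true} {i : Fin 3 // (![false, false, true] : Fin 3 → Bool) i = true} F) (⟨2, rfl⟩ : {i : Fin 3 // (![false, false, true] : Fin 3 → Bool) i = true}) (⟨2, rfl⟩ : {i : Fin 3 // (![false, false, true] : Fin 3 → Bool) i = true})) ≤ 1 ∧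
          valuation F (((m true : GL {i : Fin 3 // (![false, false, true] : Fin 3 → Bool) i = true} F) : Matrix {i : Fin 3 // (![false, false, true] : Fin 3 → Bool) i = true} {i : Fin 3 // (![false, false, true] : Fin 3 → Bool) i = true} F) (⟨2, rfl⟩ : {i : Fin 3 // (![false, false, true] : Fin 3 → Bool) i = true}) (⟨2, rfl⟩ : {i : Fin 3 // (![false, false, true] : Fin 3 → Bool) i = true}) - 1) ≤ γ ∧
          valuation F (((m⁻¹ true : GL {i : Fin 3 // (![false, false, true] : Fin 3 → Bool) i = true} F) : Matrix {i : Fin 3 // (![false, false, true] : Fin 3 → Bool) i = true} {i : Fin 3 // (![false, false, true] : Fin 3 → Bool) i = true} F) (⟨2, rfl⟩ : {i : Fin 3 // (![false, false, true] : Fin 3 → Bool) i = true}) (⟨2, rfl⟩ : {i : Fin 3 // (![false, false, true] : Fin 3 → Bool) i = true}) - 1) ≤ γ) := by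
  -- entries of `diag(m)` and `diag(m)⁻¹ = diag(m⁻¹)`
  have hinv : (blockDiagonalGL F (![false, false, true] : Fin 3 → Bool) m)⁻¹ = blockDiagonalGL F (![false, false, true] : Fin 3 → Bool) m⁻¹ := (map_inv _ _).symm
  have hinv2 : ((reindexGL e).symm (m false))⁻¹ = (reindexGL e).symm (m⁻¹ false) := by rw [← map_inv, Pi.inv_apply]
  have h22 := blockDiagonalGL_apply_two_two m; have h22' := blockDiagonalGL_apply_two_two m⁻¹
  have hone : ∀ i j : Fin 2, (1 : Matrix (Fin 3) (Fin 3) F) (Fin.castSucc i) (Fin.castSucc j) = (1 : Matrix (Fin 2) (Fin 2) F) i j := by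
    intro i j; by_cases hij : i = j
    · subst hij; rw [Matrix.one_apply_eq, Matrix.one_apply_eq]
    · rw [Matrix.one_apply_ne hij, Matrix.one_apply_ne (fun h => hij (Fin.castSucc_injective _ h))]
  have hlast : (Fin.last 2 : Fin 3) = 2 := rfl
  constructor
  · rintro ⟨⟨h1, h2⟩, h3, h4⟩
    rw [hinv] at h2 h4
    refine ⟨⟨⟨fun i j => ?_, fun i j => ?_⟩, fun i j => ?_, fun i j => ?_⟩, ?_, ?_, ?_, ?_⟩
    · rw [reindexGL_symm_block_apply e he]; exact h1 _ _
    · rw [hinv2, reindexGL_symm_block_apply e he]; exact h2 _ _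
    · rw [Matrix.sub_apply, reindexGL_symm_block_apply e he, ← hone, ← Matrix.sub_apply]; exact h3 _ _
    · rw [hinv2, Matrix.sub_apply, reindexGL_symm_block_apply e he, ← hone, ← Matrix.sub_apply]; exact h4 _ _
    · rw [← h22]; exact h1 2 2
    · rw [← h22']; exact h2 2 2
    · have := h3 2 2; rwa [Matrix.sub_apply, h22, Matrix.one_apply_eq] at this
    · have := h4 2 2; rwa [Matrix.sub_apply, h22', Matrix.one_apply_eq] at this
  · rintro ⟨⟨⟨k1, k2⟩, k3, k4⟩, t1, t2, t3, t4⟩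
    rw [hinv2] at k2 k4
    rw [mem_congruenceGL_iff, hinv]
    refine ⟨⟨fun i j => ?_, fun i j => ?_⟩, fun i j => ?_, fun i j => ?_⟩
    · induction i using Fin.lastCases with
      | last =>
        induction j using Fin.lastCases with
        | last => rw [hlast, h22]; exact t1
        | cast j => rw [hlast, blockDiagonalGL_apply_two_castSucc, map_zero]; exact zero_le
      | cast i =>
        induction j using Fin.lastCases with
        | last => rw [hlast, blockDiagonalGL_apply_castSucc_two, map_zero]; exact zero_le
        | cast j => rw [← reindexGL_symm_block_apply e he]; exact k1 i j
    · induction i using Fin.lastCases with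
      | last =>
        induction j using Fin.lastCases with
        | last => rw [hlast, h22']; exact t2
        | cast j => rw [hlast, blockDiagonalGL_apply_two_castSucc, map_zero]; exact zero_le
      | cast i =>
        induction j using Fin.lastCases with
        | last => rw [hlast, blockDiagonalGL_apply_castSucc_two, map_zero]; exact zero_le
        | cast j => rw [← reindexGL_symm_block_apply e he]; exact k2 i j
    · induction i using Fin.lastCases with
      | last =>
        induction j using Fin.lastCases with
        | last => rw [hlast, Matrix.sub_apply, h22, Matrix.one_apply_eq]; exact t3
        | cast j =>
          rw [hlast, Matrix.sub_apply, blockDiagonalGL_apply_two_castSucc, Matrix.one_apply_ne (show (2 : Fin 3) ≠ Fin.castSucc j from (Fin.castSucc_lt_last j).ne'), sub_zero, map_zero]; exact zero_le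
      | cast i =>
        induction j using Fin.lastCases with
        | last =>
          rw [hlast, Matrix.sub_apply, blockDiagonalGL_apply_castSucc_two, Matrix.one_apply_ne (show Fin.castSucc i ≠ (2 : Fin 3) from (Fin.castSucc_lt_last i).ne), sub_zero, map_zero]; exact zero_le
        | cast j => rw [Matrix.sub_apply, hone, ← reindexGL_symm_block_apply e he, ← Matrix.sub_apply]; exact k3 i j
    · induction i using Fin.lastCases with
      | last =>
        induction j using Fin.lastCases with
        | last => rw [hlast, Matrix.sub_apply, h22', Matrix.one_apply_eq]; exact t4
        | cast j =>
          rw [hlast, Matrix.sub_apply, blockDiagonalGL_apply_two_castSucc, Matrix.one_apply_ne (show (2 : Fin 3) ≠ Fin.castSucc j from (Fin.castSucc_lt_last j).ne'), sub_zero, map_zero]; exact zero_le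
      | cast i =>
        induction j using Fin.lastCases with
        | last =>
          rw [hlast, Matrix.sub_apply, blockDiagonalGL_apply_castSucc_two, Matrix.one_apply_ne (show Fin.castSucc i ≠ (2 : Fin 3) from (Fin.castSucc_lt_last i).ne), sub_zero, map_zero]; exact zero_le
        | cast j => rw [Matrix.sub_apply, hone, ← reindexGL_symm_block_apply e he, ← Matrix.sub_apply]; exact k4 i j

end Level

/-! ## §1b More level bookkeeping: the two block embeddings, the centre, compactness of the Levi level -/

section LevelTwo

variable {F : Type*} [Field F] [ValuativeRel F]
  (e : Fin 2 ≃ {i : Fin 3 // (![false, false, true] : Fin 3 → Bool) i = false})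
  (he : ∀ j : Fin 2, ((e j : {i : Fin 3 // (![false, false, true] : Fin 3 → Bool) i = false}) : Fin 3) = Fin.castSucc j)

include he in
/-- `diag(ι k) = diag(k, 1) ∈ K_γ ≤ GL₃` for `k ∈ K_γ ≤ GL₂`. [cite: BernsteinZelevinsky1976, §3.13] -/
theorem blockDiagonalGL_mulSingle_false_mem_congruenceGL {γ : ValueGroupWithZero F} (k : GL (Fin 2) F) (hk : k ∈ congruenceGL 2 γ) :
    blockDiagonalGL F (![false, false, true] : Fin 3 → Bool) (Pi.mulSingle (M := (fun a : Bool => GL {i : Fin 3 // (![false, false, true] : Fin 3 → Bool) i = a} F)) false (reindexGL e k)) ∈ congruenceGL 3 γ := by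
  rw [blockDiagonalGL_mem_congruenceGL_iff e he]
  refine ⟨by rwa [Pi.mulSingle_eq_same, MulEquiv.symm_apply_apply], ?_, ?_, ?_, ?_⟩
  all_goals first
    | rw [Pi.mulSingle_eq_of_ne (show true ≠ false by decide), Units.val_one, Matrix.one_apply_eq]
    | rw [← Pi.mulSingle_inv, Pi.mulSingle_eq_of_ne (show true ≠ false by decide), Units.val_one, Matrix.one_apply_eq]
  all_goals simp

include he in
/-- The `GL₁`-block part `d(m|_{GL₁})` of `m` with `diag(m) ∈ K_γ` again satisfies `diag ∈ K_γ`. [cite: BernsteinZelevinsky1976, §3.13] -/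
theorem blockDiagonalGL_mulSingle_true_mem_congruenceGL {γ : ValueGroupWithZero F} (m : (Π a : Bool, GL {i : Fin 3 // (![false, false, true] : Fin 3 → Bool) i = a} F))
    (hm : blockDiagonalGL F (![false, false, true] : Fin 3 → Bool) m ∈ congruenceGL 3 γ) :
    blockDiagonalGL F (![false, false, true] : Fin 3 → Bool) (Pi.mulSingle (M := (fun a : Bool => GL {i : Fin 3 // (![false, false, true] : Fin 3 → Bool) i = a} F)) true (m true)) ∈ congruenceGL 3 γ := by
  obtain ⟨-, t1, t2, t3, t4⟩ := (blockDiagonalGL_mem_congruenceGL_iff e he γ m).1 hm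
  rw [blockDiagonalGL_mem_congruenceGL_iff e he]
  refine ⟨by rw [Pi.mulSingle_eq_of_ne (show false ≠ true by decide), map_one]; exact Subgroup.one_mem _, ?_, ?_, ?_, ?_⟩
  · rwa [Pi.mulSingle_eq_same]
  · rwa [← Pi.mulSingle_inv, Pi.mulSingle_eq_same, ← Pi.inv_apply]
  · rwa [Pi.mulSingle_eq_same]
  · rwa [← Pi.mulSingle_inv, Pi.mulSingle_eq_same, ← Pi.inv_apply]

omit [ValuativeRel F] in
/-- A `1 × 1` block commutes with everything: `d(x) = ι_true(x)` is CENTRAL in the Levi `GL₂ × GL₁`. [folklore] -/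
theorem mulSingle_true_mem_center (x : GL {i : Fin 3 // (![false, false, true] : Fin 3 → Bool) i = true} F) : Pi.mulSingle (M := (fun a : Bool => GL {i : Fin 3 // (![false, false, true] : Fin 3 → Bool) i = a} F)) true x ∈ Subgroup.center (Π a : Bool, GL {i : Fin 3 // (![false, false, true] : Fin 3 → Bool) i = a} F) := by
  haveI := subsingleton_block_true
  rw [Subgroup.mem_center_iff]
  intro l
  funext b
  cases b
  · rw [Pi.mul_apply, Pi.mul_apply, Pi.mulSingle_eq_of_ne (show false ≠ true by decide), mul_one, one_mul]
  · rw [Pi.mul_apply, Pi.mul_apply, Pi.mulSingle_eq_same, eq_scalar_det_of_subsingleton x, eq_scalar_det_of_subsingleton (l true),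
      ← map_mul (Matrix.GeneralLinearGroup.scalar _), ← map_mul (Matrix.GeneralLinearGroup.scalar _), mul_comm]

variable [TopologicalSpace F] [IsNonarchimedeanLocalField F]

/-- **The Levi level `K^L_γ = {m : diag(m) ∈ K_γ}` is COMPACT**: it is closed (preimage of the closed `K_γ` under the continuous block-diagonal embedding) and contained in
the image under the continuous Levi projection of the compact `P₂₁ ∩ K_γ`. [cite: BernsteinZelevinsky1976, §3.13] -/
theorem isCompact_comap_blockDiagonalGL_congruenceGL (γ : ValueGroupWithZero F) :
    IsCompact (((congruenceGL 3 γ).comap (blockDiagonalGL F (![false, false, true] : Fin 3 → Bool)) : Subgroup (Π a : Bool, GL {i : Fin 3 // (![false, false, true] : Fin 3 → Bool) i = a} F)) : Set (Π a : Bool, GL {i : Fin 3 // (![false, false, true] : Fin 3 → Bool) i = a} F)) := by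
  haveI : IsTopologicalRing F := inferInstance
  have h1 : IsCompact (Subtype.val ⁻¹' (congruenceGL 3 γ : Set (GL (Fin 3) F)) : Set ↥(standardParabolicGL F (![false, false, true] : Fin 3 → Bool))) :=
    (isClosed_standardParabolicGL F (![false, false, true] : Fin 3 → Bool)).isClosedEmbedding_subtypeVal.isCompact_preimage (isCompact_congruenceGL γ)
  refine (h1.image (continuous_leviProjection F (![false, false, true] : Fin 3 → Bool))).of_isClosed_subset ((isClosed_congruenceGL γ).preimage (continuous_blockDiagonalGL F (![false, false, true] : Fin 3 → Bool))) fun m hm => ?_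
  exact ⟨leviEmbeddingP F (![false, false, true] : Fin 3 → Bool) m, hm, leviProjection_leviEmbeddingP_apply (![false, false, true] : Fin 3 → Bool) m⟩

/-- The Levi level `K^L_γ` is OPEN (`γ ≠ 0`). [cite: BernsteinZelevinsky1976, §3.13] -/
theorem isOpen_comap_blockDiagonalGL_congruenceGL {γ : ValueGroupWithZero F} (hγ : γ ≠ 0) :
    IsOpen (((congruenceGL 3 γ).comap (blockDiagonalGL F (![false, false, true] : Fin 3 → Bool)) : Subgroup (Π a : Bool, GL {i : Fin 3 // (![false, false, true] : Fin 3 → Bool) i = a} F)) : Set (Π a : Bool, GL {i : Fin 3 // (![false, false, true] : Fin 3 → Bool) i = a} F)) := by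
  haveI : IsTopologicalRing F := inferInstance
  exact (isOpen_congruenceGL hγ).preimage (continuous_blockDiagonalGL F (![false, false, true] : Fin 3 → Bool))

end LevelTwo

/-! ## §2 `r_Q V` is `M`-spanned by classes of bounded Levi level (Iwasawa) -/

section Generation

variable {F : Type*} [Field F] [ValuativeRel F] {X : Type*} [AddCommGroup X] [Module ℂ X] (V : Representation ℂ (GL (Fin 3) F) X)

/-- **`r_Q V` is spanned over the Levi by `K^L_γ`-fixed classes** if `V` is spanned by the `GL₃`-translates of `K_γ`-fixed vectors: Iwasawa `g = b k₀` (★ `exists_borel_mul_glInt`,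
`B ≤ P₂₁`), `K_γ ⊴ GL₃(𝒪)` (★ `conj_mem_congruenceGL`) and `[π(p) v] = r_Q(proj p)[v]` (★ `jacquetGL_leviProjection_mk`) — the `Bool`-labelled twin of ★
`span_jacquetGL_fixedPoints_eq_top_of_subset`. [cite: BernsteinZelevinsky1976, §3.17] [cite: BernsteinZelevinsky1977, §2.3] -/
theorem span_jacquetGL_fixedPoints_eq_top_of_subset {γ : ValueGroupWithZero F} {s : Set X}
    (hs : s ⊆ V.fixedPoints (congruenceGL 3 γ))
    (hgen : Submodule.span ℂ {w | ∃ g : GL (Fin 3) F, ∃ f ∈ s, w = V g f} = ⊤) :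
    Submodule.span ℂ {x | ∃ l : (Π a : Bool, GL {i : Fin 3 // (![false, false, true] : Fin 3 → Bool) i = a} F), ∃ z ∈ (jacquetGL F (![false, false, true] : Fin 3 → Bool) V).fixedPoints ((congruenceGL 3 γ).comap (blockDiagonalGL F (![false, false, true] : Fin 3 → Bool))), x = jacquetGL F (![false, false, true] : Fin 3 → Bool) V l z} = ⊤ := by
  set S := Submodule.span ℂ {x | ∃ l : (Π a : Bool, GL {i : Fin 3 // (![false, false, true] : Fin 3 → Bool) i = a} F), ∃ z ∈ (jacquetGL F (![false, false, true] : Fin 3 → Bool) V).fixedPoints ((congruenceGL 3 γ).comap (blockDiagonalGL F (![false, false, true] : Fin 3 → Bool))), x = jacquetGL F (![false, false, true] : Fin 3 → Bool) V l z} with hS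
  have hfix : ∀ w ∈ V.fixedPoints (congruenceGL 3 γ), Coinvariants.mk (restrictUnipotentGL F (![false, false, true] : Fin 3 → Bool) V) w ∈ (jacquetGL F (![false, false, true] : Fin 3 → Bool) V).fixedPoints ((congruenceGL 3 γ).comap (blockDiagonalGL F (![false, false, true] : Fin 3 → Bool))) := by
    intro w hw
    rw [mem_fixedPoints] at hw ⊢
    intro k hk
    rw [jacquetGL_mk, hw _ (Subgroup.mem_comap.1 hk)]
  have horb : ∀ (g : GL (Fin 3) F), ∀ f ∈ s, Coinvariants.mk (restrictUnipotentGL F (![false, false, true] : Fin 3 → Bool) V) (V g f) ∈ S := by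
    intro g f hf
    have hf₀ : f ∈ V.fixedPoints (congruenceGL 3 γ) := hs hf
    obtain ⟨b, hb, k₀, hk₀, rfl⟩ := exists_borel_mul_glInt g
    have hp : b ∈ standardParabolicGL F (![false, false, true] : Fin 3 → Bool) := borel_le_standardParabolicGL monotone_twoOne hb
    have hk₀f : V k₀ f ∈ V.fixedPoints (congruenceGL 3 γ) := by
      rw [mem_fixedPoints] at hf₀ ⊢
      intro k hk
      have hconj : k₀⁻¹ * k * k₀ ∈ congruenceGL 3 γ := by
        have := conj_mem_congruenceGL (Subgroup.inv_mem _ hk₀) hk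
        rwa [inv_inv] at this
      calc V k (V k₀ f) = V k₀ (V (k₀⁻¹ * k * k₀) f) := by rw [← Module.End.mul_apply, ← Module.End.mul_apply, ← map_mul, ← map_mul, ← mul_assoc, ← mul_assoc, mul_inv_cancel, one_mul]
        _ = V k₀ f := by rw [hf₀ _ hconj]
    rw [map_mul, Module.End.mul_apply, ← jacquetGL_leviProjection_mk F (![false, false, true] : Fin 3 → Bool) V ⟨b, hp⟩ (V k₀ f)]
    exact Submodule.subset_span ⟨_, _, hfix _ hk₀f, rfl⟩
  refine eq_top_iff.2 fun x _ => ?_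
  obtain ⟨v, rfl⟩ := Coinvariants.mk_surjective _ x
  have hv : v ∈ Submodule.span ℂ {w | ∃ g : GL (Fin 3) F, ∃ f ∈ s, w = V g f} := by rw [hgen]; trivial
  refine Submodule.span_induction (p := fun w _ => Coinvariants.mk (restrictUnipotentGL F (![false, false, true] : Fin 3 → Bool) V) w ∈ S) ?_ ?_ ?_ ?_ hv
  · rintro _ ⟨g, f, hf, rfl⟩
    exact horb g f hf
  · rw [map_zero]; exact S.zero_mem
  · intro a b _ _ ha hb; rw [map_add]; exact S.add_mem ha hb
  · intro a w _ hw; rw [map_smul]; exact S.smul_mem a hw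

end Generation

/-! ## §3 Central elements of small level act trivially on `r_Q V`; the `GL₂`-restriction -/

section Restriction

variable {F : Type*} [Field F] [ValuativeRel F] [TopologicalSpace F] [IsNonarchimedeanLocalField F]
  (e : Fin 2 ≃ {i : Fin 3 // (![false, false, true] : Fin 3 → Bool) i = false})
  (he : ∀ j : Fin 2, ((e j : {i : Fin 3 // (![false, false, true] : Fin 3 → Bool) i = false}) : Fin 3) = Fin.castSucc j)
  {X : Type*} [AddCommGroup X] [Module ℂ X] (V : Representation ℂ (GL (Fin 3) F) X)

/-- An element of Levi level `K^L_γ` acts on a `K^L_γ`-fixed class by the NORMALISED action as the identity (`δ_Q = 1` on `P₂₁ ∩ GL₃(𝒪)` ★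
`rootDeltaChar_eq_one_of_mem_glInt`). [cite: BernsteinZelevinsky1977, §1.8] -/
theorem normalizedJacquetGL_apply_eq_self_of_mem_fixedPoints {γ : ValueGroupWithZero F} (m : (Π a : Bool, GL {i : Fin 3 // (![false, false, true] : Fin 3 → Bool) i = a} F))
    (hm : blockDiagonalGL F (![false, false, true] : Fin 3 → Bool) m ∈ congruenceGL 3 γ) (z : (restrictUnipotentGL F (![false, false, true] : Fin 3 → Bool) V).Coinvariants) (hz : z ∈ (jacquetGL F (![false, false, true] : Fin 3 → Bool) V).fixedPoints ((congruenceGL 3 γ).comap (blockDiagonalGL F (![false, false, true] : Fin 3 → Bool)))) :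
    (normalizedJacquetGL F (![false, false, true] : Fin 3 → Bool) V) m z = z := by
  have hδ : rootDeltaChar (standardParabolicGL F (![false, false, true] : Fin 3 → Bool)) (leviEmbeddingP F (![false, false, true] : Fin 3 → Bool) m) = 1 :=
    rootDeltaChar_eq_one_of_mem_glInt _ (congruenceGL_le_glInt γ hm)
  have h1 : (normalizedJacquetGL F (![false, false, true] : Fin 3 → Bool) V) m z = (((((rootDeltaChar (standardParabolicGL F (![false, false, true] : Fin 3 → Bool))).comp (leviEmbeddingP F (![false, false, true] : Fin 3 → Bool)))⁻¹ m : ℂˣ) : ℂ)) • jacquetGL F (![false, false, true] : Fin 3 → Bool) V m z := rfl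
  rw [h1, MonoidHom.inv_apply, MonoidHom.comp_apply, hδ, inv_one, Units.val_one, one_smul]
  exact (mem_fixedPoints _ _ _).1 hz m (Subgroup.mem_comap.2 hm)

/-- **CENTRAL elements of small Levi level act TRIVIALLY on `r_Q V`**: if `r_Q V` is `M`-spanned by `K^L_γ`-fixed classes (§2), `m₀ ∈ Z(M)` and `diag(m₀) ∈ K_γ`, then
`r_Q V (m₀) = 1` — `m₀` commutes past every `l ∈ M` and fixes the generators.  In particular the `GL₁`-block congruence subgroup `d(1 + 𝔭^γ)` acts trivially.
[cite: BernsteinZelevinsky1976, §3.17] [cite: BernsteinZelevinsky1977, §2.3] -/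
theorem normalizedJacquetGL_apply_eq_self_of_mem_center {γ : ValueGroupWithZero F}
    (hspan : Submodule.span ℂ {x | ∃ l : (Π a : Bool, GL {i : Fin 3 // (![false, false, true] : Fin 3 → Bool) i = a} F), ∃ z ∈ (jacquetGL F (![false, false, true] : Fin 3 → Bool) V).fixedPoints ((congruenceGL 3 γ).comap (blockDiagonalGL F (![false, false, true] : Fin 3 → Bool))), x = jacquetGL F (![false, false, true] : Fin 3 → Bool) V l z} = ⊤)
    (m₀ : (Π a : Bool, GL {i : Fin 3 // (![false, false, true] : Fin 3 → Bool) i = a} F)) (hm₀ : m₀ ∈ Subgroup.center (Π a : Bool, GL {i : Fin 3 // (![false, false, true] : Fin 3 → Bool) i = a} F)) (hK : blockDiagonalGL F (![false, false, true] : Fin 3 → Bool) m₀ ∈ congruenceGL 3 γ) (w : (restrictUnipotentGL F (![false, false, true] : Fin 3 → Bool) V).Coinvariants) :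
    (normalizedJacquetGL F (![false, false, true] : Fin 3 → Bool) V) m₀ w = w := by
  have hδ : rootDeltaChar (standardParabolicGL F (![false, false, true] : Fin 3 → Bool)) (leviEmbeddingP F (![false, false, true] : Fin 3 → Bool) m₀) = 1 :=
    rootDeltaChar_eq_one_of_mem_glInt _ (congruenceGL_le_glInt γ hK)
  have h1 : (normalizedJacquetGL F (![false, false, true] : Fin 3 → Bool) V) m₀ w = (((((rootDeltaChar (standardParabolicGL F (![false, false, true] : Fin 3 → Bool))).comp (leviEmbeddingP F (![false, false, true] : Fin 3 → Bool)))⁻¹ m₀ : ℂˣ) : ℂ)) • jacquetGL F (![false, false, true] : Fin 3 → Bool) V m₀ w := rfl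
  rw [h1, MonoidHom.inv_apply, MonoidHom.comp_apply, hδ, inv_one, Units.val_one, one_smul]
  have hw : w ∈ Submodule.span ℂ {x | ∃ l : (Π a : Bool, GL {i : Fin 3 // (![false, false, true] : Fin 3 → Bool) i = a} F), ∃ z ∈ (jacquetGL F (![false, false, true] : Fin 3 → Bool) V).fixedPoints ((congruenceGL 3 γ).comap (blockDiagonalGL F (![false, false, true] : Fin 3 → Bool))), x = jacquetGL F (![false, false, true] : Fin 3 → Bool) V l z} := by
    rw [hspan]; trivial
  refine Submodule.span_induction (p := fun x _ => jacquetGL F (![false, false, true] : Fin 3 → Bool) V m₀ x = x) ?_ ?_ ?_ ?_ hw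
  · rintro _ ⟨l, z, hz, rfl⟩
    rw [← Module.End.mul_apply, ← map_mul, ← Subgroup.mem_center_iff.1 hm₀ l, map_mul, Module.End.mul_apply,
      (mem_fixedPoints _ _ _).1 hz m₀ (Subgroup.mem_comap.2 hK)]
  · rw [map_zero]
  · intro a b _ _ ha hb; rw [map_add, ha, hb]
  · intro a x _ hx; rw [map_smul, hx]

include he in
/-- **THE `GL₂`-RESTRICTION `(r_Q V) ∘ ι` IS ADMISSIBLE** when `r_Q V` is admissible over the Levi (★ Jacquet's lemma `isAdmissible_jacquetGL_holds`) and `M`-spanned by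
classes of Levi level `K^L_γ`, `γ ≠ 0`: for a compact open `K ≤ GL₂(F)` pick `γ′ ≤ γ` with `K_{γ′} ≤ K`; then `W^{ι K} ⊆ W^{K^L_{γ′}}` (an `m` of level `γ′` is
`ι(m|_{GL₂}) · d(m|_{GL₁})` with `m|_{GL₂} ∈ K` and `d(m|_{GL₁})` central of level `γ`, acting trivially), and `K^L_{γ′}` is compact open.
[cite: BernsteinZelevinsky1976, §3.17, Thm. 4.1] [cite: Casselman1995, §3.3] -/
theorem isAdmissible_comp_blockEmbedding {γ : ValueGroupWithZero F} (hγ : γ ≠ 0) (hW : (normalizedJacquetGL F (![false, false, true] : Fin 3 → Bool) V).IsAdmissible)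
    (hspan : Submodule.span ℂ {x | ∃ l : (Π a : Bool, GL {i : Fin 3 // (![false, false, true] : Fin 3 → Bool) i = a} F), ∃ z ∈ (jacquetGL F (![false, false, true] : Fin 3 → Bool) V).fixedPoints ((congruenceGL 3 γ).comap (blockDiagonalGL F (![false, false, true] : Fin 3 → Bool))), x = jacquetGL F (![false, false, true] : Fin 3 → Bool) V l z} = ⊤) :
    Representation.IsAdmissible ((normalizedJacquetGL F (![false, false, true] : Fin 3 → Bool) V).comp ((MonoidHom.mulSingle (fun a : Bool => GL {i : Fin 3 // (![false, false, true] : Fin 3 → Bool) i = a} F) false).comp (reindexGL e).toMonoidHom) : Representation ℂ (GL (Fin 2) F) (restrictUnipotentGL F (![false, false, true] : Fin 3 → Bool) V).Coinvariants) := by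
  haveI : IsTopologicalRing F := inferInstance
  have hcont : Continuous (((MonoidHom.mulSingle (fun a : Bool => GL {i : Fin 3 // (![false, false, true] : Fin 3 → Bool) i = a} F) false).comp (reindexGL e).toMonoidHom) : GL (Fin 2) F → (Π a : Bool, GL {i : Fin 3 // (![false, false, true] : Fin 3 → Bool) i = a} F)) := (_root_.continuous_mulSingle false).comp (continuous_reindexGL e)
  refine ⟨IsSmooth.comp_of_continuous _ _ hcont hW.isSmooth, fun K hKc => ?_⟩
  obtain ⟨γ₂, hγ₂⟩ := exists_congruenceGL_subset (K.isOpen.mem_nhds K.one_mem)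
  set γ' : ValueGroupWithZero F := min (γ₂ : ValueGroupWithZero F) γ with hγ'
  have hγ'0 : γ' ≠ 0 := (lt_min (zero_lt_iff.2 γ₂.ne_zero) (zero_lt_iff.2 hγ)).ne'
  haveI : Module.Finite ℂ ↥((normalizedJacquetGL F (![false, false, true] : Fin 3 → Bool) V).fixedPoints ((congruenceGL 3 γ').comap (blockDiagonalGL F (![false, false, true] : Fin 3 → Bool)))) :=
    hW.finite_fixedPoints ⟨(congruenceGL 3 γ').comap (blockDiagonalGL F (![false, false, true] : Fin 3 → Bool)), isOpen_comap_blockDiagonalGL_congruenceGL hγ'0⟩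
      (isCompact_comap_blockDiagonalGL_congruenceGL γ')
  have hle : Representation.fixedPoints ((normalizedJacquetGL F (![false, false, true] : Fin 3 → Bool) V).comp ((MonoidHom.mulSingle (fun a : Bool => GL {i : Fin 3 // (![false, false, true] : Fin 3 → Bool) i = a} F) false).comp (reindexGL e).toMonoidHom) : Representation ℂ (GL (Fin 2) F) (restrictUnipotentGL F (![false, false, true] : Fin 3 → Bool) V).Coinvariants) (K : Subgroup (GL (Fin 2) F)) ≤ (normalizedJacquetGL F (![false, false, true] : Fin 3 → Bool) V).fixedPoints ((congruenceGL 3 γ').comap (blockDiagonalGL F (![false, false, true] : Fin 3 → Bool))) := by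
    intro w hw
    rw [mem_fixedPoints] at hw ⊢
    intro m hm
    rw [Subgroup.mem_comap] at hm
    obtain ⟨hk, -, -, -, -⟩ := (blockDiagonalGL_mem_congruenceGL_iff e he γ' m).1 hm
    have hcentral := normalizedJacquetGL_apply_eq_self_of_mem_center V hspan (Pi.mulSingle (M := (fun a : Bool => GL {i : Fin 3 // (![false, false, true] : Fin 3 → Bool) i = a} F)) true (m true))
      (mulSingle_true_mem_center (m true)) (congruenceGL_mono (min_le_right _ _) (blockDiagonalGL_mulSingle_true_mem_congruenceGL e he m hm)) w
    calc (normalizedJacquetGL F (![false, false, true] : Fin 3 → Bool) V) m w = (normalizedJacquetGL F (![false, false, true] : Fin 3 → Bool) V) (Pi.mulSingle (M := (fun a : Bool => GL {i : Fin 3 // (![false, false, true] : Fin 3 → Bool) i = a} F)) false (m false) * Pi.mulSingle (M := (fun a : Bool => GL {i : Fin 3 // (![false, false, true] : Fin 3 → Bool) i = a} F)) true (m true)) w := by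
          rw [mulSingle_false_mul_mulSingle_true]
      _ = (normalizedJacquetGL F (![false, false, true] : Fin 3 → Bool) V) (Pi.mulSingle (M := (fun a : Bool => GL {i : Fin 3 // (![false, false, true] : Fin 3 → Bool) i = a} F)) false (m false)) w := by rw [map_mul, Module.End.mul_apply, hcentral]
      _ = ((normalizedJacquetGL F (![false, false, true] : Fin 3 → Bool) V).comp ((MonoidHom.mulSingle (fun a : Bool => GL {i : Fin 3 // (![false, false, true] : Fin 3 → Bool) i = a} F) false).comp (reindexGL e).toMonoidHom) : Representation ℂ (GL (Fin 2) F) (restrictUnipotentGL F (![false, false, true] : Fin 3 → Bool) V).Coinvariants) ((reindexGL e).symm (m false)) w := by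
          show _ = (normalizedJacquetGL F (![false, false, true] : Fin 3 → Bool) V) (Pi.mulSingle (M := (fun a : Bool => GL {i : Fin 3 // (![false, false, true] : Fin 3 → Bool) i = a} F)) false (reindexGL e ((reindexGL e).symm (m false)))) w
          rw [MulEquiv.apply_symm_apply]
      _ = w := hw _ (hγ₂ (congruenceGL_mono (min_le_left _ _) hk))
  exact Submodule.finiteDimensional_of_le hle

include he in
/-- **`(r_Q V) ∘ ι` IS `GL₂`-SPANNED BY `K_γ`-FIXED VECTORS** (the `d(t)`-translates of the `K^L_γ`-fixed classes), if `r_Q V` is `M`-spanned by `K^L_γ`-fixed classes.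
[cite: BernsteinZelevinsky1976, §3.17] [cite: BernsteinZelevinsky1977, §2.3] -/
theorem exists_generators_comp_blockEmbedding {γ : ValueGroupWithZero F}
    (hspan : Submodule.span ℂ {x | ∃ l : (Π a : Bool, GL {i : Fin 3 // (![false, false, true] : Fin 3 → Bool) i = a} F), ∃ z ∈ (jacquetGL F (![false, false, true] : Fin 3 → Bool) V).fixedPoints ((congruenceGL 3 γ).comap (blockDiagonalGL F (![false, false, true] : Fin 3 → Bool))), x = jacquetGL F (![false, false, true] : Fin 3 → Bool) V l z} = ⊤) :
    ∃ s₂ : Set (restrictUnipotentGL F (![false, false, true] : Fin 3 → Bool) V).Coinvariants, s₂ ⊆ Representation.fixedPoints ((normalizedJacquetGL F (![false, false, true] : Fin 3 → Bool) V).comp ((MonoidHom.mulSingle (fun a : Bool => GL {i : Fin 3 // (![false, false, true] : Fin 3 → Bool) i = a} F) false).comp (reindexGL e).toMonoidHom) : Representation ℂ (GL (Fin 2) F) (restrictUnipotentGL F (![false, false, true] : Fin 3 → Bool) V).Coinvariants) (congruenceGL 2 γ) ∧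
      Submodule.span ℂ {w | ∃ g : GL (Fin 2) F, ∃ f ∈ s₂, w = ((normalizedJacquetGL F (![false, false, true] : Fin 3 → Bool) V).comp ((MonoidHom.mulSingle (fun a : Bool => GL {i : Fin 3 // (![false, false, true] : Fin 3 → Bool) i = a} F) false).comp (reindexGL e).toMonoidHom) : Representation ℂ (GL (Fin 2) F) (restrictUnipotentGL F (![false, false, true] : Fin 3 → Bool) V).Coinvariants) g f} = ⊤ := by
  refine ⟨{x | ∃ y : GL {i : Fin 3 // (![false, false, true] : Fin 3 → Bool) i = true} F, ∃ z ∈ (jacquetGL F (![false, false, true] : Fin 3 → Bool) V).fixedPoints ((congruenceGL 3 γ).comap (blockDiagonalGL F (![false, false, true] : Fin 3 → Bool))), x = (normalizedJacquetGL F (![false, false, true] : Fin 3 → Bool) V) (Pi.mulSingle (M := (fun a : Bool => GL {i : Fin 3 // (![false, false, true] : Fin 3 → Bool) i = a} F)) true y) z}, ?_, ?_⟩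
  · rintro _ ⟨y, z, hz, rfl⟩
    rw [SetLike.mem_coe, mem_fixedPoints]
    intro k hk
    show (normalizedJacquetGL F (![false, false, true] : Fin 3 → Bool) V) (Pi.mulSingle (M := (fun a : Bool => GL {i : Fin 3 // (![false, false, true] : Fin 3 → Bool) i = a} F)) false (reindexGL e k)) ((normalizedJacquetGL F (![false, false, true] : Fin 3 → Bool) V) (Pi.mulSingle (M := (fun a : Bool => GL {i : Fin 3 // (![false, false, true] : Fin 3 → Bool) i = a} F)) true y) z) = _
    rw [← Module.End.mul_apply, ← map_mul, (Pi.mulSingle_commute (show false ≠ true by decide) _ _).eq, map_mul, Module.End.mul_apply,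
      normalizedJacquetGL_apply_eq_self_of_mem_fixedPoints V _ (blockDiagonalGL_mulSingle_false_mem_congruenceGL e he k hk) z hz]
  · rw [eq_top_iff, ← hspan]
    refine Submodule.span_le.2 ?_
    rintro _ ⟨l, z, hz, rfl⟩
    have h1 : (normalizedJacquetGL F (![false, false, true] : Fin 3 → Bool) V) l z = (((((rootDeltaChar (standardParabolicGL F (![false, false, true] : Fin 3 → Bool))).comp (leviEmbeddingP F (![false, false, true] : Fin 3 → Bool)))⁻¹ l : ℂˣ) : ℂ)) • jacquetGL F (![false, false, true] : Fin 3 → Bool) V l z := rfl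
    have h2 : jacquetGL F (![false, false, true] : Fin 3 → Bool) V l z =
        (((((rootDeltaChar (standardParabolicGL F (![false, false, true] : Fin 3 → Bool))).comp (leviEmbeddingP F (![false, false, true] : Fin 3 → Bool)))⁻¹ l)⁻¹ : ℂˣ) : ℂ) • (normalizedJacquetGL F (![false, false, true] : Fin 3 → Bool) V) l z := by
      rw [h1, smul_smul, Units.inv_mul, one_smul]
    rw [SetLike.mem_coe, h2]
    refine Submodule.smul_mem _ _ (Submodule.subset_span ⟨(reindexGL e).symm (l false), (normalizedJacquetGL F (![false, false, true] : Fin 3 → Bool) V) (Pi.mulSingle (M := (fun a : Bool => GL {i : Fin 3 // (![false, false, true] : Fin 3 → Bool) i = a} F)) true (l true)) z,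
      ⟨l true, z, hz, rfl⟩, ?_⟩)
    calc (normalizedJacquetGL F (![false, false, true] : Fin 3 → Bool) V) l z = (normalizedJacquetGL F (![false, false, true] : Fin 3 → Bool) V) (Pi.mulSingle (M := (fun a : Bool => GL {i : Fin 3 // (![false, false, true] : Fin 3 → Bool) i = a} F)) false (l false) * Pi.mulSingle (M := (fun a : Bool => GL {i : Fin 3 // (![false, false, true] : Fin 3 → Bool) i = a} F)) true (l true)) z := by
          rw [mulSingle_false_mul_mulSingle_true]
      _ = (normalizedJacquetGL F (![false, false, true] : Fin 3 → Bool) V) (Pi.mulSingle (M := (fun a : Bool => GL {i : Fin 3 // (![false, false, true] : Fin 3 → Bool) i = a} F)) false (l false)) ((normalizedJacquetGL F (![false, false, true] : Fin 3 → Bool) V) (Pi.mulSingle (M := (fun a : Bool => GL {i : Fin 3 // (![false, false, true] : Fin 3 → Bool) i = a} F)) true (l true)) z) := by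
          rw [map_mul, Module.End.mul_apply]
      _ = ((normalizedJacquetGL F (![false, false, true] : Fin 3 → Bool) V).comp ((MonoidHom.mulSingle (fun a : Bool => GL {i : Fin 3 // (![false, false, true] : Fin 3 → Bool) i = a} F) false).comp (reindexGL e).toMonoidHom) : Representation ℂ (GL (Fin 2) F) (restrictUnipotentGL F (![false, false, true] : Fin 3 → Bool) V).Coinvariants) ((reindexGL e).symm (l false)) ((normalizedJacquetGL F (![false, false, true] : Fin 3 → Bool) V) (Pi.mulSingle (M := (fun a : Bool => GL {i : Fin 3 // (![false, false, true] : Fin 3 → Bool) i = a} F)) true (l true)) z) := by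
          show _ = (normalizedJacquetGL F (![false, false, true] : Fin 3 → Bool) V) (Pi.mulSingle (M := (fun a : Bool => GL {i : Fin 3 // (![false, false, true] : Fin 3 → Bool) i = a} F)) false (reindexGL e ((reindexGL e).symm (l false)))) _
          rw [MulEquiv.apply_symm_apply]

end Restriction

end Summit.HodgeConjecture.HodgeConjecture.Cruxes.H413.K2E3GL3JacquetRestrictionGL2

end
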